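import Summits.ResolutionOfSingularities.ResolutionOfSingularities.Theorems.PAlterationPalterationThesisPerfectTransfer
import Summits.ResolutionOfSingularities.ResolutionOfSingularities.Theorems.PAlterationPalterationThesisStubQuotientInduction
import Summits.ResolutionOfSingularities.ResolutionOfSingularities.Theorems.PAlterationPalterationThesisStubCore
import Summits.ResolutionOfSingularities.ResolutionOfSingularities.Theorems.PAlterationPalterationThesisStubDegPOfCore
import Summits.ResolutionOfSingularities.ResolutionOfSingularities.Theorems.PAlterationPalterationThesisStubPicoverOverOfDegP
import Summits.ResolutionOfSingularities.ResolutionOfSingularities.Theorems.PAlterationPalterationThesisPerfectQuotientConverse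
import HarnessLib

/-!
# Crux `PalterationThesis` (stmt-ResolutionOfSingularities-0552), line `Sketch` rev. c2:
# PICover over a perfect field ⟺ resolution of degree-`p` radicial quotients of regular varieties

Route `ResolutionOfSingularities/pAlteration`; composition file of the rev. c2 reshape of line
`Sketch` (`--supports stmt-0552`; the crux itself stays open: it is summit-equivalent, p95862).
The four registered glue stubs of the reshape have landed (`stub_quotientInduction` p135714,
`stub_core` p135750, `stub_degP_of_core` p135543, `stub_picoverOver_of_degP` p135472), as has
the converse `hasResolution_quotient_of_picoverOver` (p135775). Assembled here, for a PERFECT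
field `K` of characteristic `p`:

* `picoverOver_of_r1` — `R1_K ⟹ PICover over K`: resolution of NORMAL DEGREE-`p` RADICIAL
  QUOTIENTS `X = W/h` of REGULAR varieties `W` (equivalently, of quotients of regular varieties
  by ONE `p`-closed rational vector field) implies the resolution of every finite radicial cover
  of a regular variety over `K` — the "FirstLemma" of the crux idea card
  `Ideas/multiplicative-residue-tame-destack.md`, by the coindex induction with Frobenius twists;
* `picoverOver_iff_r1` — **PICover over `K` ⟺ `R1_K`** (converse by Frobenius domination);
  `picoverOver_iff_expOneQuot`, `picoverOver_iff_quotient` — ⟺ resolution of exponent-one,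
  resp. arbitrary, normal radicial quotients of regular varieties;
* `picoverOver_iff_degPOver` — the fieldwise form (any field of characteristic `p`) of the
  landed `picover_iff_picoverDegP`;
* `palterationThesis_iff_pialtPerfect_r1Perfect_descent`,
  `resolutionOfSingularities_iff_pialtPerfect_r1Perfect_descent` — **the crux, equivalently
  resolution of singularities in positive characteristic, is equivalent to: the Abramovich–Oort
  conjecture over perfect fields, the resolution of degree-`p` radicial quotients of regular
  varieties over perfect fields, and `DescentPerfectToAll`** (route Descent's crux stmt-0549).

Sources: M. Temkin, *Inseparable local uniformization*, J. Algebra 373 (2013), Rem. 1.3.5;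
T. Ekedahl, *Foliations and inseparable morphisms*, Proc. Symp. Pure Math. 46 (1987) (quotients
by `p`-closed foliations ⟷ factorisations of Frobenius); the card's programme (Rudakov–Shafarevich
linearisation, Bergh–Rydh destackification) concerns the residue `R1` and is not used here.
-/

set_option linter.dupNamespace false

noncomputable section

open CategoryTheory AlgebraicGeometry TopologicalSpace
open Literature.AlgebraicGeometry.Resolution Literature.AlgebraicGeometry.Motives
open Summit.ResolutionOfSingularities.ResolutionOfSingularities.Theses.PAlteration
open Summit.ResolutionOfSingularities.ResolutionOfSingularities.Theses.Descent (DescentPerfectToAll)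

namespace Summit.ResolutionOfSingularities.ResolutionOfSingularities.Theorems.PalterationThesis.PerfectQuotient

/-! ## `R1 ⟹ PICover` over a perfect field (the FirstLemma) -/

/-- **Exponent-one quotients of every degree from `R1`** (strong induction
`stub_quotientInduction` fed with `stub_core`). [folklore] -/
theorem expOneQuot_of_r1 (p : ℕ) (hp : p.Prime) (K : Type) [Field K] [CharP K p]
    [PerfectField K]
    (hR1 : ∀ (X W : Scheme.{0}) [IsIntegral X] [IsIntegral W] (f : X ⟶ Spec (.of K))
      (h : W ⟶ X) [IsDominant h], IsSeparated f → LocallyOfFiniteType f → QuasiCompact f →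
      (∀ x : X, IsIntegrallyClosed (X.presheaf.stalk x)) → Scheme.IsRegular W →
      IsFinite h → UniversallyInjective h →
      Module.finrank X.functionField (FunctionFieldOver h) = p →
      Scheme.HasResolution X) :
    ∀ (m : ℕ) (X W : Scheme.{0}) [IsIntegral X] [IsIntegral W] (f : X ⟶ Spec (.of K))
      (h : W ⟶ X) [IsDominant h], IsSeparated f → LocallyOfFiniteType f → QuasiCompact f →
      (∀ x : X, IsIntegrallyClosed (X.presheaf.stalk x)) → Scheme.IsRegular W →
      IsFinite h → UniversallyInjective h →
      (∀ z : FunctionFieldOver h,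
        z ^ p ∈ (algebraMap X.functionField (FunctionFieldOver h)).range) →
      Module.finrank X.functionField (FunctionFieldOver h) = p ^ m →
      Scheme.HasResolution X :=
  stub_quotientInduction p hp K hR1 (stub_core p hp K)

/-- **The degree-`p` residue over a perfect field from `R1`** (`stub_degP_of_core` ∘
`stub_core` ∘ `expOneQuot_of_r1`). [folklore] -/
theorem degPOver_of_r1 (p : ℕ) (hp : p.Prime) (K : Type) [Field K] [CharP K p]
    [PerfectField K]
    (hR1 : ∀ (X W : Scheme.{0}) [IsIntegral X] [IsIntegral W] (f : X ⟶ Spec (.of K))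
      (h : W ⟶ X) [IsDominant h], IsSeparated f → LocallyOfFiniteType f → QuasiCompact f →
      (∀ x : X, IsIntegrallyClosed (X.presheaf.stalk x)) → Scheme.IsRegular W →
      IsFinite h → UniversallyInjective h →
      Module.finrank X.functionField (FunctionFieldOver h) = p →
      Scheme.HasResolution X) :
    ∀ (W : Scheme.{0}) [IsIntegral W] (f : W ⟶ Spec (.of K)) (L : Type) [Field L]
      [Algebra W.functionField L], IsSeparated f → LocallyOfFiniteType f → QuasiCompact f →
      Scheme.IsRegular W → IsPurelyInseparable W.functionField L →
      Module.finrank W.functionField L = p → Scheme.HasResolution (normalizationIn W L) :=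
  stub_degP_of_core p hp K fun M => stub_core p hp K M fun m _ => expOneQuot_of_r1 p hp K hR1 m

/-- **FirstLemma: `R1_K ⟹ PICover over K`**, `K` perfect of characteristic `p`. Resolution of
normal degree-`p` radicial quotients of regular varieties over `K` implies the resolution of
every integral finite radicial cover of a regular variety over `K`. [folklore] -/
theorem picoverOver_of_r1 (p : ℕ) (hp : p.Prime) (K : Type) [Field K] [CharP K p]
    [PerfectField K]
    (hR1 : ∀ (X W : Scheme.{0}) [IsIntegral X] [IsIntegral W] (f : X ⟶ Spec (.of K))
      (h : W ⟶ X) [IsDominant h], IsSeparated f → LocallyOfFiniteType f → QuasiCompact f →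
      (∀ x : X, IsIntegrallyClosed (X.presheaf.stalk x)) → Scheme.IsRegular W →
      IsFinite h → UniversallyInjective h →
      Module.finrank X.functionField (FunctionFieldOver h) = p →
      Scheme.HasResolution X) :
    ∀ (Y X : Scheme.{0}) (f : Y ⟶ Spec (.of K)) (g : X ⟶ Y),
      IsSeparated f → LocallyOfFiniteType f → QuasiCompact f → IsIntegral Y →
      Scheme.IsRegular Y → IsIntegral X → IsFinite g → UniversallyInjective g →
      Function.Surjective g.base → Scheme.HasResolution X :=
  stub_picoverOver_of_degP p hp K (degPOver_of_r1 p hp K hR1)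

/-! ## The equivalences over a perfect field -/

/-- **PICover over a perfect field `K` ⟺ `R1_K`**: the resolution of finite radicial covers of
regular varieties over `K` is equivalent to the resolution of normal DEGREE-`p` radicial
quotients of regular varieties over `K` (quotients by one `p`-closed rational vector field).
[folklore] -/
theorem picoverOver_iff_r1 (p : ℕ) (hp : p.Prime) (K : Type) [Field K] [CharP K p]
    [PerfectField K] :
    (∀ (Y X : Scheme.{0}) (f : Y ⟶ Spec (.of K)) (g : X ⟶ Y),
      IsSeparated f → LocallyOfFiniteType f → QuasiCompact f → IsIntegral Y →
      Scheme.IsRegular Y → IsIntegral X → IsFinite g → UniversallyInjective g →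
      Function.Surjective g.base → Scheme.HasResolution X) ↔
    ∀ (X W : Scheme.{0}) [IsIntegral X] [IsIntegral W] (f : X ⟶ Spec (.of K)) (h : W ⟶ X)
      [IsDominant h], IsSeparated f → LocallyOfFiniteType f → QuasiCompact f →
      (∀ x : X, IsIntegrallyClosed (X.presheaf.stalk x)) → Scheme.IsRegular W →
      IsFinite h → UniversallyInjective h →
      Module.finrank X.functionField (FunctionFieldOver h) = p →
      Scheme.HasResolution X :=
  ⟨r1_of_picoverOver p hp K, picoverOver_of_r1 p hp K⟩

/-- **PICover over a perfect field `K` ⟺ resolution of normal EXPONENT-ONE radicial quotients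
of regular varieties over `K`** (of every degree `p^m`). [folklore] -/
theorem picoverOver_iff_expOneQuot (p : ℕ) (hp : p.Prime) (K : Type) [Field K] [CharP K p]
    [PerfectField K] :
    (∀ (Y X : Scheme.{0}) (f : Y ⟶ Spec (.of K)) (g : X ⟶ Y),
      IsSeparated f → LocallyOfFiniteType f → QuasiCompact f → IsIntegral Y →
      Scheme.IsRegular Y → IsIntegral X → IsFinite g → UniversallyInjective g →
      Function.Surjective g.base → Scheme.HasResolution X) ↔
    ∀ (m : ℕ) (X W : Scheme.{0}) [IsIntegral X] [IsIntegral W] (f : X ⟶ Spec (.of K))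
      (h : W ⟶ X) [IsDominant h], IsSeparated f → LocallyOfFiniteType f → QuasiCompact f →
      (∀ x : X, IsIntegrallyClosed (X.presheaf.stalk x)) → Scheme.IsRegular W →
      IsFinite h → UniversallyInjective h →
      (∀ z : FunctionFieldOver h,
        z ^ p ∈ (algebraMap X.functionField (FunctionFieldOver h)).range) →
      Module.finrank X.functionField (FunctionFieldOver h) = p ^ m →
      Scheme.HasResolution X :=
  ⟨expOneQuot_of_picoverOver p hp K, fun h =>
    picoverOver_of_r1 p hp K fun X W _ _ f g _ _ _ _ hXn hW _ _ _ =>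
      hasResolution_quotient_of_picoverOver p hp K
        (stub_picoverOver_of_degP p hp K (stub_degP_of_core p hp K fun M =>
          stub_core p hp K M fun m _ => h m))
        X W f g hXn hW⟩

/-- **PICover over a perfect field `K` ⟺ resolution of ALL normal radicial quotients of regular
varieties over `K`** (any degree, any exponent). [folklore] -/
theorem picoverOver_iff_quotient (p : ℕ) (hp : p.Prime) (K : Type) [Field K] [CharP K p]
    [PerfectField K] :
    (∀ (Y X : Scheme.{0}) (f : Y ⟶ Spec (.of K)) (g : X ⟶ Y),
      IsSeparated f → LocallyOfFiniteType f → QuasiCompact f → IsIntegral Y →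
      Scheme.IsRegular Y → IsIntegral X → IsFinite g → UniversallyInjective g →
      Function.Surjective g.base → Scheme.HasResolution X) ↔
    ∀ (X W : Scheme.{0}) [IsIntegral X] [IsIntegral W] (f : X ⟶ Spec (.of K)) (h : W ⟶ X)
      [IsDominant h], IsSeparated f → LocallyOfFiniteType f → QuasiCompact f →
      (∀ x : X, IsIntegrallyClosed (X.presheaf.stalk x)) → Scheme.IsRegular W →
      IsFinite h → UniversallyInjective h → Scheme.HasResolution X :=
  ⟨fun hPC X W _ _ f h _ hs hl hq hXn hW hfin hui => by
      haveI := hs; haveI := hl; haveI := hq; haveI := hfin; haveI := hui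
      exact hasResolution_quotient_of_picoverOver p hp K hPC X W f h hXn hW,
    fun h => picoverOver_of_r1 p hp K fun X W _ _ f g _ hs hl hq hXn hW hfin hui _ =>
      h X W f g hs hl hq hXn hW hfin hui⟩

/-! ## The degree-`p` residue, fieldwise over any field -/

/-- **PICover over `K` ⟺ its degree-`p` residue over `K`**, for ANY field `K` of
characteristic `p` (the fieldwise form of `Picover.IffDegP.picover_iff_picoverDegP`): forward,
`W^L → W` is finite (E. Noether), universally injective (`W` regular hence normal, `L/K(W)`
purely inseparable) and surjective with integral source; backward, `stub_picoverOver_of_degP`.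
[cite: Temkin2013, Rem. 1.3.5 (ii)-(iii)] -/
theorem picoverOver_iff_degPOver (p : ℕ) (hp : p.Prime) (K : Type) [Field K] [CharP K p] :
    (∀ (Y X : Scheme.{0}) (f : Y ⟶ Spec (.of K)) (g : X ⟶ Y),
      IsSeparated f → LocallyOfFiniteType f → QuasiCompact f → IsIntegral Y →
      Scheme.IsRegular Y → IsIntegral X → IsFinite g → UniversallyInjective g →
      Function.Surjective g.base → Scheme.HasResolution X) ↔
    ∀ (W : Scheme.{0}) [IsIntegral W] (f : W ⟶ Spec (.of K)) (L : Type) [Field L]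
      [Algebra W.functionField L], IsSeparated f → LocallyOfFiniteType f → QuasiCompact f →
      Scheme.IsRegular W → IsPurelyInseparable W.functionField L →
      Module.finrank W.functionField L = p → Scheme.HasResolution (normalizationIn W L) := by
  refine ⟨fun hPC W _ f L _ _ hs hl hq hW hPI hdeg => ?_, stub_picoverOver_of_degP p hp K⟩
  haveI : Fact p.Prime := ⟨hp⟩
  haveI := hl
  haveI : CharP W.functionField p := Picover.TowerTransport.charP_functionField W f
  haveI : FiniteDimensional W.functionField L :=
    Module.finite_of_finrank_pos (by rw [hdeg]; exact hp.pos)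
  have hWn : ∀ w : W, IsIntegrallyClosed (W.presheaf.stalk w) := fun w => by
    haveI := hW w
    exact isIntegrallyClosed_of_isRegularLocalRing _
  haveI : IsFinite (normalizationInι W L) := isFinite_normalizationInι W L f
  haveI : UniversallyInjective (normalizationInι W L) :=
    universallyInjective_normalizationInι_of_isPurelyInseparable W L p hWn
  exact hPC W (normalizationIn W L) f (normalizationInι W L) hs hl hq inferInstance hW
    inferInstance inferInstance inferInstance (surjective_normalizationInι W L).1

/-! ## The crux and the summit with the Picover half as `R1` -/

/-- **The crux `PalterationThesis` is equivalent to: the Abramovich–Oort conjecture over perfect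
fields (`Pialt` over perfect `K`), the resolution of normal degree-`p` radicial quotients of
regular varieties over perfect fields (`R1_K`), for every prime `p`, and `DescentPerfectToAll`**
(route Descent's crux stmt-0549). This is the composition `PalterationThesis_of` of line `Sketch`
rev. c2 with its three open residues displayed. [folklore] -/
theorem palterationThesis_iff_pialtPerfect_r1Perfect_descent :
    PalterationThesis ↔
      (∀ p : ℕ, p.Prime → ∀ (K : Type) [Field K] [CharP K p] [PerfectField K],
        (∀ (X : Scheme.{0}) (f : X ⟶ Spec (.of K)),
          IsSeparated f → LocallyOfFiniteType f → QuasiCompact f → IsIntegral X →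
          ∃ (X' : Scheme.{0}) (g : X' ⟶ X), IsProper g ∧ IsIntegral X' ∧ Scheme.IsRegular X' ∧
            Function.Surjective g.base ∧ ∃ U : X.Opens, Dense (U : Set X) ∧ IsFinite (g ∣_ U) ∧
            UniversallyInjective (g ∣_ U)) ∧
        (∀ (X W : Scheme.{0}) [IsIntegral X] [IsIntegral W] (f : X ⟶ Spec (.of K))
          (h : W ⟶ X) [IsDominant h], IsSeparated f → LocallyOfFiniteType f → QuasiCompact f →
          (∀ x : X, IsIntegrallyClosed (X.presheaf.stalk x)) → Scheme.IsRegular W →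
          IsFinite h → UniversallyInjective h →
          Module.finrank X.functionField (FunctionFieldOver h) = p →
          Scheme.HasResolution X)) ∧
      DescentPerfectToAll := by
  rw [PalterationThesis.PerfectTransfer.palterationThesis_iff_perfect_and_descent]
  refine and_congr_left fun _ => ?_
  refine forall_congr' fun p => forall_congr' fun hp => forall_congr' fun K => ?_
  refine forall_congr' fun _ => forall_congr' fun _ => forall_congr' fun _ => ?_
  exact and_congr_right fun _ => picoverOver_iff_r1 p hp K

/-- **Resolution of singularities in positive characteristic is equivalent to: the
Abramovich–Oort conjecture over perfect fields, the resolution of normal degree-`p` radicial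
quotients of regular varieties over perfect fields (for every prime `p`), and
`DescentPerfectToAll`.** [folklore] -/
theorem resolutionOfSingularities_iff_pialtPerfect_r1Perfect_descent :
    _root_.ResolutionOfSingularities ↔
      (∀ p : ℕ, p.Prime → ∀ (K : Type) [Field K] [CharP K p] [PerfectField K],
        (∀ (X : Scheme.{0}) (f : X ⟶ Spec (.of K)),
          IsSeparated f → LocallyOfFiniteType f → QuasiCompact f → IsIntegral X →
          ∃ (X' : Scheme.{0}) (g : X' ⟶ X), IsProper g ∧ IsIntegral X' ∧ Scheme.IsRegular X' ∧
            Function.Surjective g.base ∧ ∃ U : X.Opens, Dense (U : Set X) ∧ IsFinite (g ∣_ U) ∧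
            UniversallyInjective (g ∣_ U)) ∧
        (∀ (X W : Scheme.{0}) [IsIntegral X] [IsIntegral W] (f : X ⟶ Spec (.of K))
          (h : W ⟶ X) [IsDominant h], IsSeparated f → LocallyOfFiniteType f → QuasiCompact f →
          (∀ x : X, IsIntegrallyClosed (X.presheaf.stalk x)) → Scheme.IsRegular W →
          IsFinite h → UniversallyInjective h →
          Module.finrank X.functionField (FunctionFieldOver h) = p →
          Scheme.HasResolution X)) ∧
      DescentPerfectToAll :=
  palterationThesis_iff_resolutionOfSingularities.symm.trans
    palterationThesis_iff_pialtPerfect_r1Perfect_descent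

/-- **Over a perfect field: resolution of singularities ⟺ PIAlt and `R1`.** Over a perfect
field `K` of characteristic `p`, every reduced separated `K`-scheme of finite type has a
resolution iff PIAlt holds over `K` and normal degree-`p` radicial quotients of regular
varieties over `K` are resolvable. [folklore] -/
theorem perfectRes_iff_pialtOver_and_r1 (p : ℕ) (hp : p.Prime) (K : Type) [Field K]
    [CharP K p] [PerfectField K] :
    (∀ (X : Scheme.{0}) (f : X ⟶ Spec (.of K)),
      IsSeparated f → LocallyOfFiniteType f → QuasiCompact f → IsReduced X →
      Scheme.HasResolution X) ↔
    ((∀ (X : Scheme.{0}) (f : X ⟶ Spec (.of K)),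
          IsSeparated f → LocallyOfFiniteType f → QuasiCompact f → IsIntegral X →
          ∃ (X' : Scheme.{0}) (g : X' ⟶ X), IsProper g ∧ IsIntegral X' ∧ Scheme.IsRegular X' ∧
            Function.Surjective g.base ∧ ∃ U : X.Opens, Dense (U : Set X) ∧ IsFinite (g ∣_ U) ∧
            UniversallyInjective (g ∣_ U)) ∧
      (∀ (X W : Scheme.{0}) [IsIntegral X] [IsIntegral W] (f : X ⟶ Spec (.of K))
          (h : W ⟶ X) [IsDominant h], IsSeparated f → LocallyOfFiniteType f → QuasiCompact f →
          (∀ x : X, IsIntegrallyClosed (X.presheaf.stalk x)) → Scheme.IsRegular W →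
          IsFinite h → UniversallyInjective h →
          Module.finrank X.functionField (FunctionFieldOver h) = p →
          Scheme.HasResolution X)) := by
  rw [← PalterationThesis.PerfectTransfer.pialtOver_and_picoverOver_iff_perfectField p hp K]
  exact and_congr_right fun _ => picoverOver_iff_r1 p hp K

end Summit.ResolutionOfSingularities.ResolutionOfSingularities.Theorems.PalterationThesis.PerfectQuotient

end
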